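import Summits.Ventures.HodgeRepro.CongruenceHermitianCover

/-!
# The congruence level of A4's iterated `Γ″` on the rational points of any Hermitian form (seat p5)

Blind re-derivation cell `pub-hodge-repro`, seat `p5`.  Addendum to `CongruenceHermitianCover.lean`
(route-3's request, INBOX 2026-08-22T04:32:16Z): the iterated `Γ″ = Γ′ ⊓ ⨅ᵢ γᵢ⁻¹ Γ′ γᵢ` of ROUTE.md A4
«Iteration (R5)» is not only of finite index in `Γ′` but a CONGRUENCE subgroup — it contains the principal
congruence subgroup `Γ(L)` of the common level `L = M · ∏ᵢ Nᵢ² ≠ 0` (`Nᵢ` a denominator of `γᵢ`), both in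
`U(H_K)(K)` and transported into `U(p,1)` along `toUp`.  (BMM's Corollary 2 is stated for CONGRUENCE
quotients `Γ″\𝔹^p`; finite index in `Γ′` alone does not make `Γ″` congruence.)  Built on p5's
`CongruenceGen.congr_le_inf_conjSubG` (the congruence half of Hecke conjugation, `Γ(N² M) ≤ Γ′ ⊓ g⁻¹ Γ′ g`),
`CongruenceHermitian.exists_denominator_GL` (common denominators in `𝓞_K`) and
`CongruenceHermitianCover.lemmaW_iter_finiteCover_ratPointsOf`.  Mathlib otherwise.

* `exists_congrU_le_inf_conjSubG` — one `K`-point `g`: `Γ(N² M) ≤ Γ′ ⊓ g⁻¹ Γ′ g` inside `U(H_K)(K)`;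
* `exists_congrU_le_inf_iInf_conjSubG` — finitely many `gᵢ`: `Γ(M ∏ᵢ Nᵢ²) ≤ Γ′ ⊓ ⨅ᵢ gᵢ⁻¹ Γ′ gᵢ`;
* `map_inf_iInf_conjSubG_le` / `map_inf_iInf_conjSubG` — transport of the iterated `Γ″` along a homomorphism
  (equality for an injective one and a non-empty family);
* `exists_congrU_map_le_inf_iInf_conjSubG_ratPointsOf` — the congruence clause inside `U(p,1)`: for rational
  `γᵢ ∈ ratPointsOf`, `toUp(Γ(L)) ≤ toUp(Γ′) ⊓ ⨅ᵢ γᵢ⁻¹ toUp(Γ′) γᵢ` for some `L ≠ 0`;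
* **`lemmaW_iter_congruenceCover_ratPointsOf`** — `lemmaW_iter_finiteCover_ratPointsOf` with the congruence
  clause added: rational `γ₁ … γ_p`, `γ₁^*ω₁ ∧ ⋯ ∧ γ_p^*ω_p ≢ 0`, invariant under `Γ″`, `Γ″ ⊇ toUp(Γ(L))`
  with `L ≠ 0`, and `Γ″` of finite index in `toUp(Γ′)`.

Nothing here says anything about the status of the Hodge conjecture for CM abelian varieties.
-/

set_option autoImplicit false

noncomputable section

namespace Summit.Ventures.HodgeRepro

namespace CongHerm

open Matrix
open NumberField
open HodgeRepro.BallGen (Idx GLp U Ball unitaryGroupOf ratPointsOf pullback)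
open HodgeRepro.BallGen.Inv (IsInvariant IsInvariantTop topForm)
open CongGen

/-! ### Transport of the iterated `Γ″` along a homomorphism -/

section transport

variable {G G' : Type} [Group G] [Group G']

/-- **Transport of the iterated `Γ″`.**  For any homomorphism `ψ`,
`ψ(Γ′ ⊓ ⨅ᵢ gᵢ⁻¹ Γ′ gᵢ) ≤ ψ(Γ′) ⊓ ⨅ᵢ ψ(gᵢ)⁻¹ ψ(Γ′) ψ(gᵢ)`. -/
theorem map_inf_iInf_conjSubG_le (ψ : G →* G') (Γ' : Subgroup G) {ι : Type} (g : ι → G) :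
    (Γ' ⊓ ⨅ i, conjSubG (g i) Γ').map ψ ≤ Γ'.map ψ ⊓ ⨅ i, conjSubG (ψ (g i)) (Γ'.map ψ) := by
  refine (Subgroup.map_inf_le _ _ _).trans (inf_le_inf_left _ (le_iInf fun i => ?_))
  rw [← map_conjSubG]
  exact Subgroup.map_mono (iInf_le _ i)

/-- For an injective `ψ` and a non-empty family the transport is an equality:
`ψ(Γ′ ⊓ ⨅ᵢ gᵢ⁻¹ Γ′ gᵢ) = ψ(Γ′) ⊓ ⨅ᵢ ψ(gᵢ)⁻¹ ψ(Γ′) ψ(gᵢ)`. -/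
theorem map_inf_iInf_conjSubG {ψ : G →* G'} (hψ : Function.Injective ψ) (Γ' : Subgroup G) {ι : Type}
    [Nonempty ι] (g : ι → G) :
    (Γ' ⊓ ⨅ i, conjSubG (g i) Γ').map ψ = Γ'.map ψ ⊓ ⨅ i, conjSubG (ψ (g i)) (Γ'.map ψ) := by
  rw [Subgroup.map_inf _ _ _ hψ, Subgroup.map_iInf _ hψ]
  simp only [map_conjSubG]

end transport

/-! ### The congruence level in `U(H_K)(K)` -/

variable {p : ℕ} {K : Type} [Field K] [NumberField K] [IsCMField K]
variable (HK : Matrix (Idx p) (Idx p) K)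

/-- **One Hecke element: `Γ′ ⊓ g⁻¹ Γ′ g` is a congruence subgroup.**  For `Γ(M) ≤ Γ′ ≤ U(H_K)(K)`, `M ≠ 0`,
and every `K`-point `g`, there is `L ≠ 0` (namely `L = N² M` for a denominator `N` of `g`) with
`Γ(L) ≤ Γ′ ⊓ g⁻¹ Γ′ g`. -/
theorem exists_congrU_le_inf_conjSubG {Γ' : Subgroup (unitaryGroupOf HK)} {M : 𝓞 K} (hM0 : M ≠ 0)
    (hM : congrU HK M ≤ Γ') (g : unitaryGroupOf HK) :
    ∃ L : 𝓞 K, L ≠ 0 ∧ congrU HK L ≤ Γ' ⊓ conjSubG g Γ' := by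
  obtain ⟨N, hN, A, B, hA, hB⟩ := exists_denominator_GL (g : GL (Idx p) K)
  exact ⟨N ^ 2 * M, mul_ne_zero (pow_ne_zero 2 hN) hM0,
    congr_le_inf_conjSubG (unitaryGroupOf HK) (φO K) (φO_injective (K := K)) hM g A B hA hB⟩

/-- **Finitely many Hecke elements: a common congruence level.**  For `Γ(M) ≤ Γ′ ≤ U(H_K)(K)`, `M ≠ 0`, and
finitely many `K`-points `g₁, …, g_k`, the iterated `Γ″ = Γ′ ⊓ ⨅ᵢ gᵢ⁻¹ Γ′ gᵢ` contains the principal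
congruence subgroup of the common level `L = M · ∏ᵢ Nᵢ² ≠ 0` (`Nᵢ` a denominator of `gᵢ`). -/
theorem exists_congrU_le_inf_iInf_conjSubG {Γ' : Subgroup (unitaryGroupOf HK)} {M : 𝓞 K} (hM0 : M ≠ 0)
    (hM : congrU HK M ≤ Γ') {ι : Type} [Finite ι] (g : ι → unitaryGroupOf HK) :
    ∃ L : 𝓞 K, L ≠ 0 ∧ congrU HK L ≤ Γ' ⊓ ⨅ i, conjSubG (g i) Γ' := by
  cases nonempty_fintype ι
  choose N hN A B hA hB using fun i => exists_denominator_GL ((g i : unitaryGroupOf HK) : GL (Idx p) K)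
  refine ⟨M * ∏ i, N i ^ 2,
    mul_ne_zero hM0 (Finset.prod_ne_zero_iff.2 fun i _ => pow_ne_zero 2 (hN i)),
    le_inf ((congr_le_congr_of_dvd _ _ _ (Dvd.intro _ rfl)).trans hM) (le_iInf fun i => ?_)⟩
  have hdvd : N i ^ 2 * M ∣ M * ∏ j, N j ^ 2 := by
    rw [mul_comm (N i ^ 2) M]
    exact mul_dvd_mul_left M (Finset.dvd_prod_of_mem _ (Finset.mem_univ i))
  exact (congr_le_congr_of_dvd _ _ _ hdvd).trans
    ((congr_le_inf_conjSubG (unitaryGroupOf HK) (φO K) (φO_injective (K := K)) hM (g i) (A i) (B i)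
      (hA i) (hB i)).trans inf_le_right)

/-! ### The congruence level inside `U(p,1)` -/

variable (φ₀ : K →+* ℂ) (P : GLp p)
  (hP : (P : Matrix (Idx p) (Idx p) ℂ)ᴴ * HK.map φ₀ * (P : Matrix (Idx p) (Idx p) ℂ) = HodgeRepro.BallGen.J p)

/-- **The congruence clause of A4's iterated `Γ″`, inside `U(p,1)`.**  For `Γ(M) ≤ Γ′ ≤ U(H_K)(K)`, `M ≠ 0`,
transported to `U(p,1)` by `toUp`, and finitely many rational `γᵢ ∈ ratPointsOf`, there is `L ≠ 0` with
`toUp(Γ(L)) ≤ toUp(Γ′) ⊓ ⨅ᵢ γᵢ⁻¹ toUp(Γ′) γᵢ`: the iterated `Γ″` is a congruence subgroup. -/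
theorem exists_congrU_map_le_inf_iInf_conjSubG_ratPointsOf {Γ' : Subgroup (unitaryGroupOf HK)} {M : 𝓞 K}
    (hM0 : M ≠ 0) (hM : congrU HK M ≤ Γ') {ι : Type} [Finite ι] (γ : ι → U p)
    (hγ : ∀ i, γ i ∈ ratPointsOf φ₀ HK P hP) :
    ∃ L : 𝓞 K, L ≠ 0 ∧ (congrU HK L).map (toUp HK φ₀ P hP) ≤
      Γ'.map (toUp HK φ₀ P hP) ⊓ ⨅ i, conjSubG (γ i) (Γ'.map (toUp HK φ₀ P hP)) := by
  have hγ' : ∀ i, ∃ g : unitaryGroupOf HK, toUp HK φ₀ P hP g = γ i := fun i => hγ i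
  choose g hg using hγ'
  obtain ⟨L, hL, hle⟩ := exists_congrU_le_inf_iInf_conjSubG HK hM0 hM g
  refine ⟨L, hL, (Subgroup.map_mono hle).trans ?_⟩
  have h := map_inf_iInf_conjSubG_le (toUp HK φ₀ P hP) Γ' g
  simpa only [hg] using h

/-- **Lemma W for every `p` with its CONGRUENCE finite cover, on the rational points of an arbitrary
Hermitian form of signature `(p,1)` over a CM field (ROUTE.md A4, «Iteration (R5)», congruence clause
included).**  Let `Γ(M) ≤ Γ′ ≤ U(H_K)(𝓞_K)`, `M ≠ 0`, be transported to `U(p,1)` by `toUp`, and let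
`ω₁, …, ω_p` be continuous cotangent fields on `𝔹^p`, each non-zero somewhere and invariant under the
transported `Γ′`.  Then there are rational `γ₁, …, γ_p ∈ ratPointsOf` such that the `(p,0)`-form
`γ₁^*ω₁ ∧ ⋯ ∧ γ_p^*ω_p` is not identically zero, is invariant under `Γ″ = Γ′ ⊓ ⨅ᵢ γᵢ⁻¹ Γ′ γᵢ`, `Γ″` contains
the transported principal congruence subgroup `Γ(L)` for some `L ≠ 0`, and `Γ″` has finite index in `Γ′`. -/
theorem lemmaW_iter_congruenceCover_ratPointsOf {Γ' : Subgroup (unitaryGroupOf HK)} (hΓ : Γ' ≤ arithU HK)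
    {M : 𝓞 K} (hM0 : M ≠ 0) (hM : congrU HK M ≤ Γ') (ω : Fin p → Ball p → Fin p → ℂ)
    (hω : ∀ j, Continuous (ω j)) (hω0 : ∀ j, ∃ w, ω j w ≠ 0)
    (hωΓ : ∀ j, IsInvariant (Γ'.map (toUp HK φ₀ P hP)) (ω j)) :
    ∃ γ : Fin p → U p, (∀ j, γ j ∈ ratPointsOf φ₀ HK P hP) ∧
      (topForm fun j => pullback (γ j) (ω j)) ≠ 0 ∧
      IsInvariantTop (Γ'.map (toUp HK φ₀ P hP) ⊓ ⨅ j, conjSubG (γ j) (Γ'.map (toUp HK φ₀ P hP)))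
        (topForm fun j => pullback (γ j) (ω j)) ∧
      (∃ L : 𝓞 K, L ≠ 0 ∧ (congrU HK L).map (toUp HK φ₀ P hP) ≤
        Γ'.map (toUp HK φ₀ P hP) ⊓ ⨅ j, conjSubG (γ j) (Γ'.map (toUp HK φ₀ P hP))) ∧
      (Γ'.map (toUp HK φ₀ P hP) ⊓ ⨅ j, conjSubG (γ j) (Γ'.map (toUp HK φ₀ P hP))).IsFiniteRelIndex
        (Γ'.map (toUp HK φ₀ P hP)) := by
  obtain ⟨γ, hγ, hne, hinv, hfin⟩ :=
    lemmaW_iter_finiteCover_ratPointsOf HK φ₀ P hP hΓ hM0 hM ω hω hω0 hωΓ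
  exact ⟨γ, hγ, hne, hinv, exists_congrU_map_le_inf_iInf_conjSubG_ratPointsOf HK φ₀ P hP hM0 hM γ hγ, hfin⟩

end CongHerm

end Summit.Ventures.HodgeRepro

end
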